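import Summits.QuantumFields.BalabanUV.Beta.D1BFx.PeriodisedProjector
import Summits.QuantumFields.BalabanUV.Beta.D1BFx.SortedReblocking

/-!
# `BalabanUV.Beta.D1BFx.TorusScalarAveraging` — road «BF-x», binder row D1, slot (K), X₃(ii) ROUTE T, brick **K-TB3c PART 2, FILE 1∕2**
# «THE TORUS BLOCK-AVERAGING OPERATOR»: the rectangular two-scale object `Qind : Matrix (Site 4 p) (Site 4 s) ℝ` (the torus block indicator =
# the un-normalised block averaging `(Q̂′*)ᵀ`, `s = (m+1)·p`), its Gram identities `Qindᵀ·Qind = Ŝ`, `Qind·Qindᵀ = (m+1)⁴•1`, its kernel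
# (`Qind·λ = 0 ↔ Ŝ·λ = 0`), the tower operator in bordered shape `ÂX = (m+1)²•L̂ + Qindᵀ·((a/(m+1)⁴)•1)·Qind`, THE TWO-SCALE UNFOLD
# `Qind·(periodise₂ s K)^·Qindᵀ = (periodise₂ p (blockSum m K))^`, and the sorted-currency reading `Qind ∘ torusBlockEquiv = 1[coarse index]`.
# FILE 2∕2 = `D1BFx/TorusScalarCoarseGram` (the `S₀`-letter `Qind·Ĝ′·Ĝ′·Qindᵀ = (m+1)⁴•k̂erSq` and its inverse `(m+1)⁻⁴•Ĉsq`).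

HONEST DEPENDENCY (cell records, verbatim): «continuum YM on T⁴ ⇐ BetaPertH ∧ nine spine estimates (0/9 proved); BetaPertH ⇐ (D1) ∧ (D4) ∧
CAP+tail; G-an2-4 gates asym, D1 and NE2/3/4.»  HONEST FRAMING (cell contract, verbatim): «discharging `BetaPertH` makes Bałaban's UV stability
UNCONDITIONAL — a real constructive-QFT result; it is NOT the continuum limit and NOT the Clay problem.»  THIS MODULE DISCHARGES NOTHING of (K),
of D1 or of the wall: [folklore] two-scale lattice bookkeeping over an4's `EntrywiseVolumeLimit` (`periodise₂`, `periodise₂_eq_tsum_of_rep`,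
`summable_row_imageShift`, `IsPeriodic₂`), pv23's `B6QGQLower276` (`blk`, `B`, `chart`, `mem_B`, `sum_B_const`) and `B5Hk103ScalarZd.summable_blocks`,
the owner's `PeriodisedKernels` (`valRep`, `tblk`, `tblk_lt`, `periodise₂_sameBlk`, `imageShift_eq_add_side_smul`) and `PeriodisedProjector` (`Shat`,
`Lhat`, `AXhat`, `AXhat_eq`, `Shat_mulVec_eq_zero_iff`, `sum_B_add`), the typer's `GhostLeg` (`blk_translate`, `blk_pred_apply`, `side_pred`) and
leaf-03's `SortedReblocking` (`torusBlockEquiv`, `quo_finePt`, `siteOf_add_zsmul`, `imageShift_mul_eq_add`) — all USED BY NAME.  Three data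
definitions [our object] (`tq`, `Qind`, `blockSum`; no `def … : Prop`), nothing cited, 0 sorry.  NOT D1, NOT BetaPertH, NOT continuum, NOT Clay.

ABSOLUTE RULE (cell charter, verbatim): «No internally-minted statement may enter as a cited fact. Every hypothesis is either kernel-proved in this
package or a verbatim quotation of a PUBLISHED theorem with page reference. The manuscript(s) under audit are NOT citable for their own disputed
steps — they are the thing under adjudication; programme-internal (2001/route/tribunal) claims are never citable.»

WHERE THIS SITS (`HOME/b2b-balaban-beta-d1-p2/K-ASSEMBLY-SPEC-v2.md` v2.3 §2 row K-TB3c «GHOST LEGS ON THE TORUS → ℤ⁴», «OPEN — after K-TB3a»;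
`OWNER-MEMO-g6.md` §2; PART 1 = ne9-leaf-09-g38's `TorusGhostLegs` ∕ `TorusGhostGram`, whose docstrings leave «NOT HERE (K-TB3c PART 2):
`Q̂′·((Ggh)^)²·Q̂′ᵀ = n⁴•(KsqK)^` on the torus (scalar twin of 3b-Q(ii) `TorusAveragingGram`)»).  After K-TB3a (`GhostSplitJets` p239077 ∕
`GhostCompressionJets` p239613) the ghost side of the owner's DECISION 2 is consumed by TB5 through the THREE LEG SOCKETS of
`GhostSplitJets.hessT_kkt_sq_jets_of_mul_eq_one` — `kkt X₀ Q₀ * L = 1`, `M₀ * Gm = 1`, `S₀ * Gs = 1`, `X₀ = M₀·M₀`, `S₀ = Q₀·X₀⁻¹·Q₀ᵀ` — after the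
compression step `GhostCompressionJets.hessT_compressed_jets` (`Q·N = 0`, `det(Q·Qᵀ) ≠ 0`) and the shift step `hessT_kkt_shift_sq_jets`
(`M₀ = Δ₀ + Qᵀ(a₀Q)`).  At `U = 1` on the fine torus `Site 4 s`, `s = (m+1)·p` (pv23 block side `m+1`): `M₀ = ÂX`, `Gm = Ĝ′`
(`PeriodisedProjector.Ghat_mul_AXhat`, IN TREE); `Q₀` is the RECTANGULAR block-averaging matrix from the fine torus `Site 4 s` to the coarse torus
`Site 4 p` — two different tori, so NOT the periodisation of a `ℤ⁴` kernel — typed HERE as `Qind` with exactly the facts those sockets ask of it;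
FILE 2 identifies `S₀ = Qind·(ÂX·ÂX)⁻¹·Qindᵀ = (m+1)⁴•k̂erSq` and `Gs = (m+1)⁻⁴•Ĉsq`.
CONTENT (d = 4, pv23 block side `m+1`, fine torus `Beta.Site 4 s`, coarse torus `Beta.Site 4 p`, `hs : s = (m+1)·p`):
* §1 [our object] `tq m p : Site 4 s → Site 4 p` (torus block label as a coarse torus point), **`Qind m s p`** (`Qind ȳ z = 1[tq z = ȳ]`); [folklore]
  representatives (`valRep_siteOf_of_window`, `tq_eq_iff : tq z = ȳ ↔ tblk m z = valRep ȳ`, `filter_tq_eq`: a torus block IS the pv23 block of its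
  representative, `sum_filter_tq`, `card_filter_tq = (m+1)⁴`, surjectivity `tq_siteOf_smul_valRep`), **`Qind_transpose_mul_Qind : Qindᵀ·Qind = Ŝ`**,
  **`Qind_mul_Qind_transpose : Qind·Qindᵀ = (m+1)⁴•1`**, `det_Qind_mul_Qind_transpose_ne_zero` (the `hQ` socket), `Qind_mulVec_apply` (torus block
  sums), **`Qind_mulVec_eq_zero_iff : Qind·λ = 0 ↔ Ŝ·λ = 0`** (with K-TB3b FILE 1's `Ŝλ = 0 ↔ λ ∈ range N̂`: the `hQN` socket),
  **`AXhat_eq_lap_add_border`** (the `hM₀` shape of `hessT_kkt_shift_sq_jets`).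
* §2 [our object] `blockSum m K`; [folklore] `isPeriodic₂_blockSum`, `summable_blockSum_row`, `Qind_mul_mul_Qind_transpose_apply`, and **THE TWO-SCALE
  UNFOLD `Qind_mul_periodise₂_mul_Qind_transpose`** (representatives in `[0, s)⁴`, the image series pulled through the two finite block sums,
  `B m (y′ + p•n) = B m y′ + s•n`).
* §3 [folklore] SORTED-CURRENCY READING (DECISION 1): `tq_siteOf : tq (n−1) p [x] = [quo n x]` for ANY representative, **`tq_torusBlockEquiv : tq ∘
  torusBlockEquiv n p = Prod.fst`**, `Qind_torusBlockEquiv`, `Qind_submatrix_torusBlockEquiv` (`Qind` re-indexed by `SortedReblocking.torusBlockEquiv`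
  is the coarse-index Kronecker delta, constant along the in-block coordinate).
NOT HERE: FILE 2; the S-JETS as periodised coarse arrays of the unit-class Gram rows (dictionary of record, after TB4-tables); anything of K-TB3b∕K-TB3d.
Provenance: NE9 formalisation swarm leaf seat `b2b-balaban-t4-ne9-formalise-leaf-02` gen 26 (cross-row prover duty NE9 → β∕D1 road «BF-x»; journal CLAIM
«K-TB3c PART 2» l.22923), 2026-08-20.
-/

noncomputable section

namespace Summit.QuantumFields.BalabanUV.Beta.D1BFx.TorusScalarAveraging

open Finset Matrix
open scoped BigOperators
open Literature.MathematicalPhysics.QuantumFieldTheory.Balaban1983to89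
open Literature.MathematicalPhysics.QuantumFieldTheory.Balaban1983to89.Beta
open B6QGQLower276 (X side blk B mem_B lapKer sameBlk AX sum_B sum_B_const chart blk_chart)
open B5Hk103ScalarZd (summable_blocks)
open Summit.QuantumFields.BalabanUV.Beta.D1BFx.GhostLeg (blk_translate)
open Summit.QuantumFields.BalabanUV.Beta.D1BFx.PeriodisedKernels
open Summit.QuantumFields.BalabanUV.Beta.D1BFx.PeriodisedProjector

/-! ## §1 The torus block label as a coarse torus point; the block indicator `Qind` -/

/-- [our object] **THE TORUS BLOCK LABEL AS A COARSE TORUS POINT**: `tq m p z := siteOf 4 p (tblk m z)` — the block of the fine torus point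
`z ∈ (ℤ∕s)⁴` read on the coarse torus `(ℤ∕p)⁴` (`s = (m+1)·p`). -/
def tq (m : ℕ) {s : ℕ} (p : ℕ) [NeZero s] (z : Site 4 s) : Site 4 p := siteOf 4 p (tblk m z)

/-- [our object] **THE TORUS BLOCK INDICATOR** `Qind m s p : Matrix (Site 4 p) (Site 4 s) ℝ`, `Qind yb z = 1[tq z = yb]` — the un-normalised
block-averaging operator (the transpose of `Q̂′* : ω ↦ ω ∘ blk`) from fine torus site functions to coarse torus site functions. -/
def Qind (m s p : ℕ) [NeZero s] : Matrix (Site 4 p) (Site 4 s) ℝ := Matrix.of fun yb z => if tq m p z = yb then 1 else 0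

section Blocks

variable {m s p : ℕ}

/-- [folklore] Entries of `Qind`. -/
@[simp] theorem Qind_apply [NeZero s] (yb : Site 4 p) (z : Site 4 s) : Qind m s p yb z = if tq m p z = yb then 1 else 0 := rfl

/-- [folklore] `valRep ∘ siteOf = id` on the window `[0, s)⁴`. -/
theorem valRep_siteOf_of_window [NeZero s] (x : X 4) (h0 : ∀ i, 0 ≤ x i) (hlt : ∀ i, x i < (s : ℤ)) :
    valRep (siteOf 4 s x) = x := by
  funext i
  simp only [valRep, siteOf]
  rw [ZMod.val_intCast, Int.emod_eq_of_lt (h0 i) (hlt i)]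

/-- [folklore] Two window points with the same torus class are equal. -/
theorem eq_of_siteOf_eq_of_window [NeZero p] {x y : X 4} (h : siteOf 4 p x = siteOf 4 p y) (hx0 : ∀ i, 0 ≤ x i)
    (hxlt : ∀ i, x i < (p : ℤ)) (hy0 : ∀ i, 0 ≤ y i) (hylt : ∀ i, y i < (p : ℤ)) : x = y := by
  rw [← valRep_siteOf_of_window x hx0 hxlt, ← valRep_siteOf_of_window y hy0 hylt, h]

/-- [folklore] `tq z = yb ↔ tblk m z = valRep yb` (`s = (m+1)·p`: the block label lies in the window `[0, p)⁴`). -/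
theorem tq_eq_iff [NeZero s] [NeZero p] (hs : s = (m + 1) * p) (z : Site 4 s) (yb : Site 4 p) :
    tq m p z = yb ↔ tblk m z = valRep yb := by
  constructor
  · intro h
    refine eq_of_siteOf_eq_of_window (p := p) ?_ (tblk_nonneg m z) (tblk_lt m hs z) (valRep_nonneg yb) (valRep_lt yb)
    rw [siteOf_valRep]; exact h
  · intro h
    show siteOf 4 p (tblk m z) = yb
    rw [h, siteOf_valRep]

/-- [folklore] `tq z = tq z′ ↔ tblk m z = tblk m z′`. -/
theorem tq_eq_tq_iff [NeZero s] [NeZero p] (hs : s = (m + 1) * p) (z z' : Site 4 s) :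
    tq m p z = tq m p z' ↔ tblk m z = tblk m z' := by
  rw [tq_eq_iff hs, (tq_eq_iff hs z' (tq m p z')).1 rfl]

/-- [folklore] A point of a block whose label lies in `[0, p)⁴` lies in the window `[0, s)⁴`. -/
theorem window_of_mem_B (hs : s = (m + 1) * p) {y x : X 4} (hx : x ∈ B m y) (hy0 : ∀ i, 0 ≤ y i) (hylt : ∀ i, y i < (p : ℤ)) :
    (∀ i, 0 ≤ x i) ∧ ∀ i, x i < (s : ℤ) := by
  obtain ⟨w, -, rfl⟩ := Finset.mem_image.1 hx
  have hs' : (s : ℤ) = ((m : ℤ) + 1) * (p : ℤ) := by rw [hs]; push_cast; ring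
  refine ⟨fun i => ?_, fun i => ?_⟩
  · simp only [chart, side]
    have := hy0 i
    positivity
  · simp only [chart, side]
    have h1 : (((w i : ℕ) : ℤ)) ≤ (m : ℤ) := by exact_mod_cast Nat.lt_succ_iff.mp (w i).isLt
    have h2 : y i + 1 ≤ (p : ℤ) := hylt i
    have h3 : ((m : ℤ) + 1) * (y i + 1) ≤ ((m : ℤ) + 1) * (p : ℤ) := mul_le_mul_of_nonneg_left h2 (by positivity)
    rw [hs']
    linarith

/-- [folklore] The representative of the torus class of a window point of a block is the point. -/
theorem valRep_siteOf_of_mem_B [NeZero s] (hs : s = (m + 1) * p) {y x : X 4} (hx : x ∈ B m y) (hy0 : ∀ i, 0 ≤ y i)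
    (hylt : ∀ i, y i < (p : ℤ)) : valRep (siteOf 4 s x) = x :=
  valRep_siteOf_of_window x (window_of_mem_B hs hx hy0 hylt).1 (window_of_mem_B hs hx hy0 hylt).2

variable [NeZero s] [NeZero p]

/-- [folklore] **A TORUS BLOCK IS A BLOCK OF ITS REPRESENTATIVE**: the fibre of `tq` over `yb` is the image under `siteOf` of the `ℤ⁴` block
`B m (valRep yb)`. -/
theorem filter_tq_eq (hs : s = (m + 1) * p) (yb : Site 4 p) :
    Finset.univ.filter (fun z : Site 4 s => tq m p z = yb) = (B m (valRep yb)).image (siteOf 4 s) := by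
  ext z
  simp only [Finset.mem_filter, Finset.mem_univ, true_and, Finset.mem_image]
  constructor
  · intro h
    exact ⟨valRep z, mem_B.2 ((tq_eq_iff hs z yb).1 h), siteOf_valRep z⟩
  · rintro ⟨x, hx, rfl⟩
    rw [tq_eq_iff hs, tblk, valRep_siteOf_of_mem_B hs hx (valRep_nonneg yb) (valRep_lt yb)]
    exact mem_B.1 hx

/-- [folklore] `siteOf` is injective on such a block. -/
theorem siteOf_injOn_B (hs : s = (m + 1) * p) (yb : Site 4 p) : Set.InjOn (siteOf 4 s) ↑(B m (valRep yb)) := by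
  intro x hx x' hx' h
  rw [← valRep_siteOf_of_mem_B hs (Finset.mem_coe.1 hx) (valRep_nonneg yb) (valRep_lt yb),
    ← valRep_siteOf_of_mem_B hs (Finset.mem_coe.1 hx') (valRep_nonneg yb) (valRep_lt yb), h]

/-- [folklore] **SUMS OVER A TORUS BLOCK ARE SUMS OVER THE `ℤ⁴` BLOCK OF ITS REPRESENTATIVE** (through `valRep`). -/
theorem sum_filter_tq (hs : s = (m + 1) * p) (yb : Site 4 p) (f : X 4 → ℝ) :
    ∑ z ∈ Finset.univ.filter (fun z : Site 4 s => tq m p z = yb), f (valRep z) = ∑ x ∈ B m (valRep yb), f x := by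
  rw [filter_tq_eq hs, Finset.sum_image (siteOf_injOn_B hs yb)]
  exact Finset.sum_congr rfl fun x hx => by rw [valRep_siteOf_of_mem_B hs hx (valRep_nonneg yb) (valRep_lt yb)]

/-- [folklore] The same for torus functions: `Σ_{tq z = yb} g z = Σ_{x ∈ B m (valRep yb)} g (siteOf x)`. -/
theorem sum_filter_tq' (hs : s = (m + 1) * p) (yb : Site 4 p) (g : Site 4 s → ℝ) :
    ∑ z ∈ Finset.univ.filter (fun z : Site 4 s => tq m p z = yb), g z = ∑ x ∈ B m (valRep yb), g (siteOf 4 s x) := by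
  rw [filter_tq_eq hs, Finset.sum_image (siteOf_injOn_B hs yb)]

/-- [folklore] A torus block has `(m+1)⁴` points. -/
theorem card_filter_tq (hs : s = (m + 1) * p) (yb : Site 4 p) :
    ((Finset.univ.filter (fun z : Site 4 s => tq m p z = yb)).card : ℝ) = ((m : ℝ) + 1) ^ 4 := by
  have h := sum_filter_tq' hs yb (fun _ => (1 : ℝ))
  rw [Finset.sum_const, nsmul_eq_mul, mul_one, sum_B_const, mul_one] at h
  exact h

/-- [folklore] `tq` is surjective: the torus class of the block corner `side m • valRep yb` has label `yb`. -/
theorem tq_siteOf_smul_valRep (hs : s = (m + 1) * p) (yb : Site 4 p) : tq m p (siteOf 4 s (side m • valRep yb)) = yb := by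
  have hmem : side m • valRep yb ∈ B m (valRep yb) := by
    rw [mem_B]
    have h := blk_translate m (0 : X 4) (valRep yb)
    rw [zero_add] at h
    rw [h]
    funext i
    simp only [Pi.add_apply, blk, Pi.zero_apply]
    rw [Int.zero_ediv, zero_add]
  rw [tq_eq_iff hs, tblk, valRep_siteOf_of_mem_B hs hmem (valRep_nonneg yb) (valRep_lt yb)]
  exact mem_B.1 hmem

/-- [folklore] **`Qindᵀ·Qind = Ŝ`** — the fine × fine torus block indicator (`PeriodisedKernels.periodise₂_sameBlk`). -/
theorem Qind_transpose_mul_Qind (hs : s = (m + 1) * p) : (Qind m s p)ᵀ * Qind m s p = Shat m s := by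
  ext z z'
  rw [Matrix.mul_apply, Shat_apply, periodise₂_sameBlk m hs]
  simp only [Matrix.transpose_apply, Qind_apply]
  rw [Finset.sum_eq_single (tq m p z)]
  · rw [if_pos rfl, one_mul]
    by_cases h : tblk m z = tblk m z'
    · rw [if_pos h, if_pos ((tq_eq_tq_iff hs z' z).2 h.symm)]
    · rw [if_neg h, if_neg (fun h' => h ((tq_eq_tq_iff hs z' z).1 h').symm)]
  · intro yb _ hne
    rw [if_neg (Ne.symm hne), zero_mul]
  · intro h; exact absurd (Finset.mem_univ _) h

/-- [folklore] **`Qind·Qindᵀ = (m+1)⁴•1`** — every torus block has `(m+1)⁴` points and distinct blocks are disjoint. -/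
theorem Qind_mul_Qind_transpose (hs : s = (m + 1) * p) :
    Qind m s p * (Qind m s p)ᵀ = (((m : ℝ) + 1) ^ 4) • (1 : Matrix (Site 4 p) (Site 4 p) ℝ) := by
  ext yb yb'
  rw [Matrix.mul_apply, Matrix.smul_apply, Matrix.one_apply, smul_eq_mul]
  simp only [Matrix.transpose_apply, Qind_apply]
  by_cases h : yb = yb'
  · subst h
    have e : ∀ z : Site 4 s, ((if tq m p z = yb then (1 : ℝ) else 0) * if tq m p z = yb then 1 else 0) = if tq m p z = yb then 1 else 0 :=
      fun z => by split_ifs <;> simp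
    simp only [e, Finset.sum_boole, if_true, mul_one]
    exact card_filter_tq hs yb
  · rw [if_neg h, mul_zero]
    refine Finset.sum_eq_zero fun z _ => ?_
    by_cases h1 : tq m p z = yb
    · rw [if_neg (fun h2 : tq m p z = yb' => h (h1.symm.trans h2)), mul_zero]
    · rw [if_neg h1, zero_mul]

/-- [folklore] `det (Qind·Qindᵀ) ≠ 0` (the `hQ` socket of `GhostCompressionJets.hessT_compressed_jets`). -/
theorem det_Qind_mul_Qind_transpose_ne_zero (hs : s = (m + 1) * p) : (Qind m s p * (Qind m s p)ᵀ).det ≠ 0 := by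
  rw [Qind_mul_Qind_transpose hs, Matrix.det_smul, Matrix.det_one, mul_one]
  exact pow_ne_zero _ (by positivity)

omit [NeZero p] in
/-- [folklore] **THE ACTION OF `Qind` IS THE TORUS BLOCK SUM**: `(Qind·λ)(yb) = Σ_{tq z = yb} λ z`. -/
theorem Qind_mulVec_apply (lam : Site 4 s → ℝ) (yb : Site 4 p) :
    (Qind m s p *ᵥ lam) yb = ∑ z ∈ Finset.univ.filter (fun z : Site 4 s => tq m p z = yb), lam z := by
  simp only [Matrix.mulVec, dotProduct, Qind_apply]
  rw [Finset.sum_filter]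
  exact Finset.sum_congr rfl fun z _ => by split_ifs <;> simp

/-- [folklore] **`Qind·λ = 0 ↔ Ŝ·λ = 0`** — both say: every torus block sum of `λ` vanishes (with K-TB3b FILE 1's `Ŝλ = 0 ↔ λ ∈ range N̂`
this is the `hQN : Q·N = 0` socket of `GhostCompressionJets.hessT_compressed_jets`). -/
theorem Qind_mulVec_eq_zero_iff (hs : s = (m + 1) * p) (lam : Site 4 s → ℝ) :
    Qind m s p *ᵥ lam = 0 ↔ Shat m s *ᵥ lam = 0 := by
  rw [Shat_mulVec_eq_zero_iff hs]
  constructor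
  · intro h z₀
    have h1 := congr_fun h (tq m p z₀)
    rw [Qind_mulVec_apply, Pi.zero_apply] at h1
    have hset : Finset.univ.filter (fun z : Site 4 s => tq m p z = tq m p z₀) = Finset.univ.filter (fun z => tblk m z = tblk m z₀) :=
      Finset.filter_congr fun z _ => tq_eq_tq_iff hs z z₀
    rw [← hset]; exact h1
  · intro h
    funext yb
    rw [Qind_mulVec_apply, Pi.zero_apply]
    have hset : Finset.univ.filter (fun z : Site 4 s => tq m p z = yb)
        = Finset.univ.filter (fun z => tblk m z = tblk m (siteOf 4 s (side m • valRep yb))) :=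
      Finset.filter_congr fun z _ => by rw [← tq_eq_tq_iff hs, tq_siteOf_smul_valRep hs]
    rw [hset]; exact h _

/-- [folklore] **`ÂX = (m+1)²•L̂ + Qindᵀ·((a/(m+1)⁴)•1)·Qind`** — the tower operator on the torus in the `Δ₀ + Qᵀ(a₀Q)` shape of
`GhostCompressionJets.hessT_kkt_shift_sq_jets` (`PeriodisedProjector.AXhat_eq` + `Qind_transpose_mul_Qind`). -/
theorem AXhat_eq_lap_add_border (a : ℝ) (hs : s = (m + 1) * p) :
    AXhat m a s = (((m : ℝ) + 1) ^ 2) • Lhat s + (Qind m s p)ᵀ * ((a / ((m : ℝ) + 1) ^ 4) • (1 : Matrix (Site 4 p) (Site 4 p) ℝ)) * Qind m s p := by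
  rw [Matrix.mul_smul, Matrix.mul_one, Matrix.smul_mul, Qind_transpose_mul_Qind hs, AXhat_eq]

end Blocks

/-! ## §2 THE TWO-SCALE UNFOLD: `Qind · (periodise₂ s K)^ · Qindᵀ = (periodise₂ p (blockSum m K))^` -/

/-- [our object] **BLOCK SUMS OF A FINE KERNEL**: `blockSum m K y y′ := Σ_{x ∈ B m y} Σ_{x′ ∈ B m y′} K x x′` — the coarse `ℤ⁴` kernel of
`Q̂′*ᵀ·K·Q̂′*` (un-normalised block averaging on both sides). -/
def blockSum (m : ℕ) (K : Kernel₂ 4) (y y' : X 4) : ℝ := ∑ x ∈ B m y, ∑ x' ∈ B m y', K x x'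

section Unfold

variable (m : ℕ) {s p : ℕ}

omit m in
/-- [folklore] `imageShift p y n = y + p•n`. -/
theorem imageShift_eq_add_zsmul (p : ℕ) (y n : X 4) : imageShift p y n = y + (p : ℤ) • n := by
  funext i; simp [imageShift_apply]

/-- [folklore] **JOINT `s`-PERIODICITY OF `K` ⟹ JOINT `p`-PERIODICITY OF ITS BLOCK SUMS** (`s = (m+1)·p`). -/
theorem isPeriodic₂_blockSum (hs : s = (m + 1) * p) {K : Kernel₂ 4} (hK : IsPeriodic₂ s K) : IsPeriodic₂ p (blockSum m K) := by
  intro y y' n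
  simp only [blockSum]
  rw [imageShift_eq_add_zsmul, imageShift_eq_add_zsmul, sum_B_add]
  refine Finset.sum_congr rfl fun x _ => ?_
  rw [sum_B_add]
  refine Finset.sum_congr rfl fun x' _ => ?_
  rw [← imageShift_eq_add_side_smul m hs, ← imageShift_eq_add_side_smul m hs]
  exact hK x x' n

/-- [folklore] Rows of `blockSum m K` are summable when the rows of `K` are (`B5Hk103ScalarZd.summable_blocks`). -/
theorem summable_blockSum_row {K : Kernel₂ 4} (hrow : ∀ x, Summable (K x)) (y : X 4) : Summable (blockSum m K y) :=
  summable_sum fun x _ => summable_blocks m (hrow x)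

variable [NeZero s] [NeZero p]

omit [NeZero p] in
/-- [folklore] Entries of `Qind·M·Qindᵀ`: the double torus-block sum of `M`. -/
theorem Qind_mul_mul_Qind_transpose_apply (M : Matrix (Site 4 s) (Site 4 s) ℝ) (yb yb' : Site 4 p) :
    (Qind m s p * M * (Qind m s p)ᵀ) yb yb'
      = ∑ z ∈ Finset.univ.filter (fun z : Site 4 s => tq m p z = yb), ∑ z' ∈ Finset.univ.filter (fun z' : Site 4 s => tq m p z' = yb'), M z z' := by
  simp only [Matrix.mul_apply, Matrix.transpose_apply, Qind_apply, Finset.sum_mul]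
  rw [Finset.sum_comm, Finset.sum_filter]
  refine Finset.sum_congr rfl fun z _ => ?_
  rw [Finset.sum_filter]
  by_cases h : tq m p z = yb
  · simp only [h, ↓reduceIte, one_mul]
    exact Finset.sum_congr rfl fun z' _ => by split_ifs <;> simp
  · simp only [h, ↓reduceIte, zero_mul, Finset.sum_const_zero]

/-- [folklore] **THE TWO-SCALE UNFOLD.**  For a jointly `s`-periodic fine kernel `K` with summable rows and `s = (m+1)·p`:
`Qind · (periodise₂ s K)^ · Qindᵀ = (periodise₂ p (blockSum m K))^` — summing the fine-torus matrix of `K` over two torus blocks gives the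
coarse-torus matrix of the block-summed `ℤ⁴` kernel (representatives in `[0, s)⁴`, the image series pulled through the two finite block sums, and
`B m (y′ + p•n) = B m y′ + s•n`). -/
theorem Qind_mul_periodise₂_mul_Qind_transpose (hs : s = (m + 1) * p) {K : Kernel₂ 4} (hK : IsPeriodic₂ s K)
    (hrow : ∀ x, Summable (K x)) :
    Qind m s p * Matrix.of (periodise₂ s K) * (Qind m s p)ᵀ = Matrix.of (periodise₂ p (blockSum m K)) := by
  ext yb yb'
  rw [Qind_mul_mul_Qind_transpose_apply, Matrix.of_apply,
    periodise₂_eq_tsum_of_rep (isPeriodic₂_blockSum m hs hK) (summable_blockSum_row m hrow) (siteOf_valRep yb) (siteOf_valRep yb')]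
  -- every fine entry through the representatives `valRep`
  have e1 : ∀ z z' : Site 4 s, Matrix.of (periodise₂ s K) z z' = ∑' n : X 4, K (valRep z) (imageShift s (valRep z') n) :=
    fun z z' => periodise₂_eq_tsum_of_rep hK hrow (siteOf_valRep z) (siteOf_valRep z')
  simp only [e1]
  -- the two torus-block sums are `ℤ⁴` block sums of the representatives
  rw [Finset.sum_congr rfl fun z _ => sum_filter_tq hs yb' (fun x' => ∑' n : X 4, K (valRep z) (imageShift s x' n)),
    sum_filter_tq hs yb (fun x => ∑ x' ∈ B m (valRep yb'), ∑' n : X 4, K x (imageShift s x' n))]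
  -- pull the image series through the two finite sums
  have hsn : ∀ x x' : X 4, Summable fun n : X 4 => K x (imageShift s x' n) := fun x x' => summable_row_imageShift hrow x x'
  rw [Finset.sum_congr rfl fun x _ => (Summable.tsum_finsetSum fun x' _ => hsn x x').symm,
    ← Summable.tsum_finsetSum fun x _ => summable_sum fun x' _ => hsn x x']
  refine tsum_congr fun n => ?_
  simp only [blockSum]
  rw [imageShift_eq_add_zsmul]
  refine Finset.sum_congr rfl fun x _ => ?_
  rw [sum_B_add]
  refine Finset.sum_congr rfl fun x' _ => ?_
  rw [imageShift_eq_add_side_smul m hs]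

end Unfold

/-! ## §3 Bridge to the SORTED currency (DECISION 1): `Qind` through `SortedReblocking.torusBlockEquiv` is the coarse-index Kronecker delta -/

section Sorted

open Literature.Probability.LatticeModels (TorusSite)
open Literature.MathematicalPhysics.QuantumFieldTheory.LatticeForm (quo)
open Summit.QuantumFields.BalabanUV.Beta.D1BFx.SortedReblocking (finePt torusBlockEquiv torusBlockEquiv_apply quo_finePt siteOf_add_zsmul
  imageShift_mul_eq_add)
open Summit.QuantumFields.BalabanUV.Beta.D1BFx.GhostLeg (blk_pred_apply side_pred)

variable (n p : ℕ) [NeZero n] [NeZero p]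

omit [NeZero p] in
/-- [folklore] pv23's block label at block side `n = (n−1)+1` is the cell's `quo n`. -/
theorem blk_pred_eq_quo (x : X 4) : blk (n - 1) x = quo n x := by
  funext μ; rw [blk_pred_apply]; rfl

omit [NeZero p] in
/-- [folklore] Block labels along fine translations by `n • t`. -/
theorem blk_pred_add_zsmul (x t : X 4) : blk (n - 1) (x + (n : ℤ) • t) = blk (n - 1) x + t := by
  rw [← side_pred n, blk_translate]

/-- [folklore] **THE TORUS BLOCK LABEL OF A FINE CLASS IS THE CLASS OF THE BLOCK LABEL**: `tq (n−1) p [x] = [quo n x]` on the fine torus `Site 4 (n·p)`,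
for ANY representative `x` (the `[0, n·p)⁴` representative differs from `x` by an `(n·p)`-multiple, which moves the block label by a `p`-multiple). -/
theorem tq_siteOf (x : X 4) : tq (n - 1) p (siteOf 4 (n * p) x) = siteOf 4 p (quo n x) := by
  obtain ⟨t₁, ht₁⟩ := exists_eq_imageShift_of_siteOf_eq (s := n * p) (y := x) (x := siteOf 4 (n * p) x) rfl
  obtain ⟨t₂, ht₂⟩ := exists_eq_imageShift_of_siteOf_eq (s := n * p) (y := valRep (siteOf 4 (n * p) x)) (x := siteOf 4 (n * p) x)
    (siteOf_valRep _)
  rw [imageShift_mul_eq_add] at ht₁ ht₂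
  show siteOf 4 p (blk (n - 1) (valRep (siteOf 4 (n * p) x))) = siteOf 4 p (quo n x)
  rw [ht₂, blk_pred_add_zsmul, siteOf_add_zsmul, ← blk_pred_eq_quo n]
  conv_rhs => rw [ht₁, blk_pred_add_zsmul, siteOf_add_zsmul]

/-- [folklore] **`tq ∘ torusBlockEquiv = Prod.fst`**: in the sorted coordinates `(ȳ, z) ↦ [finePt n y z]` of the fine torus the block label IS the coarse
coordinate. -/
theorem tq_torusBlockEquiv (q : Site 4 p × TorusSite 4 n) : tq (n - 1) p (torusBlockEquiv n p q) = q.1 := by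
  rw [torusBlockEquiv_apply, tq_siteOf, quo_finePt, siteOf_windowMap]

/-- [folklore] **`Qind` IN SORTED COORDINATES IS THE COARSE KRONECKER DELTA** (constant along the in-block coordinate):
`Qind (n−1) (n·p) p ȳ (torusBlockEquiv n p q) = 1[q.1 = ȳ]`. -/
theorem Qind_torusBlockEquiv (yb : Site 4 p) (q : Site 4 p × TorusSite 4 n) :
    Qind (n - 1) (n * p) p yb (torusBlockEquiv n p q) = if q.1 = yb then 1 else 0 := by
  rw [Qind_apply, tq_torusBlockEquiv]

/-- [folklore] The same as a re-indexed matrix: `Qind.submatrix id torusBlockEquiv = of (ȳ, (ȳ′, z)) ↦ 1[ȳ′ = ȳ]`. -/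
theorem Qind_submatrix_torusBlockEquiv :
    (Qind (n - 1) (n * p) p).submatrix id (torusBlockEquiv n p) = Matrix.of fun yb q => if q.1 = yb then (1 : ℝ) else 0 := by
  ext yb q
  rw [Matrix.submatrix_apply, Matrix.of_apply, id, Qind_torusBlockEquiv]

end Sorted

end Summit.QuantumFields.BalabanUV.Beta.D1BFx.TorusScalarAveraging

end
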